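import Summits.Langlands.Langlands.Theses.IrreducibilityBySelfDuality
import Summits.Langlands.Langlands.Theorems.IrreducibilityBySelfDualityReducibleForcesEssSelfDual

/-!
# `ReducibleForcesEssSelfDual` — closure by name (item stmt-Langlands-13619)

The route decl `Summit.Langlands.Langlands.Theses.IrreducibilityBySelfDuality.ReducibleForcesEssSelfDual`
stated BY NAME and closed by the theorem `ReducibleForcesEssSelfDual.reducibleForcesEssSelfDual_of`
(module `…Theorems.IrreducibilityBySelfDualityReducibleForcesEssSelfDual`, which states the same text
verbatim and does not import the Theses file).  Böckle–Hui 2025, §3.2.1.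
-/

set_option linter.dupNamespace false -- project-wide option (lakefile weak.linter.dupNamespace); `Summit.Langlands.Langlands` is the mandated namespace

namespace Summit.Langlands.Langlands.Theorems

/-- **`ReducibleForcesEssSelfDual` holds** (item stmt-Langlands-13619 of route
`IrreducibilityBySelfDuality`): Böckle–Hui §3.2.1 field-independent and cofinite — a reducible
semisimple `r` compatible a.e. with a regular algebraic cuspidal `π` on `GL_3` forces `π` to be
essentially self-dual at Satake level, and `r` never has three independent stable lines.  Alias of
`ReducibleForcesEssSelfDual.reducibleForcesEssSelfDual_of`. [cite: BockleHui2025, §3.2.1] -/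
theorem ReducibleForcesEssSelfDual_proof :
    Summit.Langlands.Langlands.Theses.IrreducibilityBySelfDuality.ReducibleForcesEssSelfDual :=
  ReducibleForcesEssSelfDual.reducibleForcesEssSelfDual_of

end Summit.Langlands.Langlands.Theorems
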